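import Mathlib.Probability.ProbabilityMassFunction.Constructions
import Mathlib.Probability.ProbabilityMassFunction.Integrals
import Mathlib.MeasureTheory.Measure.ProbabilityMeasure
import Mathlib.MeasureTheory.Integral.Bochner.Basic
import Mathlib.MeasureTheory.Measure.Lebesgue.Basic
import Mathlib.Analysis.SpecialFunctions.Complex.Log
import Mathlib.Analysis.Convex.Function
import Mathlib.Analysis.Calculus.Deriv.Basic
import Literature.Probability.LatticeModels.LeeYang
import HarnessLib

/-!
# The Lee–Yang property, Ising magnetization laws and Ising limit laws

Trunk T-STATMECH (Literature/Probability/LatticeModels); definition request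
`defn-IsIsingLimitLaw` (route RiemannHypothesis/LeeYang, items #0, #2, #6). Sibling of
`LeeYang.lean`, which holds the named fact `lee_yang_circle_theorem_finite` (Lee–Yang 1952,
App. II, fields with `Re hᵢ > 0`); this file builds the measure-theoretic vocabulary on top of it.

* `HasLeeYangProperty μ` — all zeros of the two-sided Laplace transform `z ↦ ∫ e^{zu} dμ(u)` of a
  measure `μ` on `ℝ` lie on the imaginary axis (Lee–Yang 1952; Newman 1974, §1).
* `isingMagnetizationLaw n J w` — the law of the weighted magnetization `Σᵢ wᵢ sᵢ`, `sᵢ = ±1`,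
  under the finite Ising Gibbs probability `∝ exp(Σᵢⱼ Jᵢⱼ sᵢ sⱼ)` on `Fin n → Bool` with GENERAL
  pair couplings `J` (a finite mixture of Dirac masses, built with Mathlib `PMF`).
* `IsIsingLimitLaw ν` — `ν` is a weak limit of such laws with FERROMAGNETIC couplings `J ≥ 0` and
  weights `w ≥ 0`, with `exp(b u²)`-moments bounded uniformly along the sequence for every `b`
  (the hypothesis making Laplace transforms converge, Newman 1974).
* PROVED from `lee_yang_circle_theorem_finite`: `lee_yang_ising_of_pos` (partition function
  `Z(z) = Σ_s e^{Σ Jᵢⱼ sᵢ sⱼ + z Σ wᵢ sᵢ} ≠ 0` off the imaginary axis, for STRICTLY positive weights;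
  the `Re z < 0` half by the global spin flip), the Laplace-transform identity
  `∫ e^{zu} d(law) = Z(z)/Z(0)` (`integral_exp_isingMagnetizationLaw`) and hence
  `hasLeeYangProperty_isingMagnetizationLaw` from `lee_yang_ising`.
* Named facts: `lee_yang_ising` — the extension of `lee_yang_circle_theorem_finite` admitting zero
  weights `wᵢ ≥ 0` (Hurwitz in the fields / Lieb–Sokal 1981, §3; needed because `IsIsingLimitLaw`
  allows `w ≥ 0`); closure under Ising limits (`hasLeeYangProperty_of_isIsingLimitLaw`, Newman 1974 /
  Lieb–Sokal 1981); the GHS inequality (`ghs_isingMagnetizationLaw`); Simon–Griffiths'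
  approximation of `e^{-au⁴-bu²} du` by Ising spins (`isIsingLimitLaw_phi4`).

## Sources

* T. D. Lee, C. N. Yang, Phys. Rev. 87 (1952) 410, Thm. 3 (uniform field) and Appendix II
  (general fields); T. Asano, J. Phys. Soc. Japan 29 (1970) 350.
* C. M. Newman, *Zeros of the partition function for generalized Ising systems*, CPAM 27 (1974)
  143–159, §1 (Lee–Yang property of a measure) and Thm. 1 / Thm. 3.
* E. H. Lieb, A. D. Sokal, *A general Lee–Yang theorem for one-component and multicomponent
  ferromagnets*, CMP 80 (1981) 153–179, §2–3.
* R. B. Griffiths, C. A. Hurst, S. Sherman, J. Math. Phys. 11 (1970) 790 (GHS);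
  R. S. Ellis, J. L. Monroe, C. M. Newman, CMP 46 (1976) 167 (GHS and consequences).
* B. Simon, R. B. Griffiths, *The (φ⁴)₂ field theory as a classical Ising model*, CMP 33 (1973)
  145–164 (`GriffithsSimon1973`).

## Design choices

* General pair couplings on `Fin n` (NOT the graph/uniform-coupling `isingMeasure` of
  `IsingModel.lean`); the diagonal terms `Jᵢᵢ sᵢ² = Jᵢᵢ` only change the normalisation. A bridge to
  `isingMeasure G Λ β 0 .free` is left to a later item (it needs `SpinConfig`/`Finset` plumbing).
* `isingMagnetizationLaw` is an honest `ProbabilityMeasure ℝ`: `PMF.ofFintype` of the normalised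
  Boltzmann weights, pushed forward by the magnetization, `PMF.toMeasure`.
* Weak convergence is convergence in Mathlib's topology on `ProbabilityMeasure ℝ`.
* Facts are stated for `J ≥ 0` entrywise and `w ≥ 0` (zero weights allowed: the Lee–Yang property
  persists by Hurwitz, cf. Lieb–Sokal); GHS on `[0, ∞)`.
* `HasLeeYangProperty μ` uses Mathlib's Bochner integral, whose junk value on non-integrable
  integrands is `0`; so the property FORCES `u ↦ e^{(Re z) u}` to be `μ`-integrable at every `z` off
  the imaginary axis — heavy-tailed measures and the zero measure fail it. This is consistent with
  Newman's class (measures with `∫ e^{bu²} dμ < ∞` for all `b`), cf. Newman 1974, §1.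
-/

noncomputable section

open MeasureTheory Filter Topology
open scoped ENNReal

namespace Literature.Probability.LatticeModels

/-! ### The Lee–Yang property -/

/-- **The Lee–Yang property** of a (finite, typically probability) measure `μ` on `ℝ`: every zero
`z ∈ ℂ` of its two-sided Laplace transform `∫ e^{zu} dμ(u)` is purely imaginary. (For laws with
Gaussian-dominated tails the transform is entire; with Mathlib's junk `∫ = 0` for non-integrable
integrands, the property forces integrability of `e^{(Re z)u}` off the axis, so the zero measure and
heavy-tailed measures do NOT have it.) [Lee–Yang 1952, Thm. 3; Newman 1974, §1 (Def. of the
Lee–Yang property)] [cite: Newman1974, §1] -/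
def HasLeeYangProperty (μ : Measure ℝ) : Prop :=
  ∀ z : ℂ, (∫ u, Complex.exp (z * u) ∂μ) = 0 → z.re = 0

/-! ### Finite Ising systems with general pair couplings -/

section Finite

variable {n : ℕ}

/-- The spin `sᵢ = ±1` of a Boolean configuration. [Lee–Yang 1952, §II] [folklore] -/
def spinVal (s : Fin n → Bool) (i : Fin n) : ℝ :=
  if s i then 1 else -1

/-- The (negative) energy `Σᵢⱼ Jᵢⱼ sᵢ sⱼ` of a configuration for pair couplings `J`.
[Lee–Yang 1952, eq. (1) and Appendix II; Newman 1974, §1] [cite: LeeYang1952, Appendix II] -/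
def isingPairEnergy (J : Fin n → Fin n → ℝ) (s : Fin n → Bool) : ℝ :=
  ∑ i, ∑ j, J i j * spinVal s i * spinVal s j

/-- The Boltzmann weight `exp(Σᵢⱼ Jᵢⱼ sᵢ sⱼ) > 0`. [Lee–Yang 1952, §II] [folklore] -/
def isingBoltzmann (J : Fin n → Fin n → ℝ) (s : Fin n → Bool) : ℝ :=
  Real.exp (isingPairEnergy J s)

/-- The partition function `Z = Σ_s exp(Σᵢⱼ Jᵢⱼ sᵢ sⱼ) > 0`. [Lee–Yang 1952, eq. (2)] [folklore] -/
def isingPairPartition (J : Fin n → Fin n → ℝ) : ℝ :=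
  ∑ s : Fin n → Bool, isingBoltzmann J s

/-- The weighted magnetization `M_w(s) = Σᵢ wᵢ sᵢ`. [Newman 1974, §1] [folklore] -/
def weightedMagnetization (w : Fin n → ℝ) (s : Fin n → Bool) : ℝ :=
  ∑ i, w i * spinVal s i

/-- The Boltzmann weights are positive. [folklore] -/
theorem isingBoltzmann_pos (J : Fin n → Fin n → ℝ) (s : Fin n → Bool) : 0 < isingBoltzmann J s :=
  Real.exp_pos _

/-- The partition function is positive. [folklore] -/
theorem isingPairPartition_pos (J : Fin n → Fin n → ℝ) : 0 < isingPairPartition J :=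
  Finset.sum_pos (fun s _ => isingBoltzmann_pos J s) Finset.univ_nonempty

/-- The finite Ising Gibbs probability `s ↦ exp(Σ Jᵢⱼ sᵢ sⱼ) / Z` as a Mathlib `PMF` on
configurations. [Lee–Yang 1952, §II and Appendix II; Newman 1974, §1] [cite: LeeYang1952, Appendix II] -/
def isingPairPMF (J : Fin n → Fin n → ℝ) : PMF (Fin n → Bool) :=
  PMF.ofFintype (fun s => ENNReal.ofReal (isingBoltzmann J s / isingPairPartition J)) (by
    rw [← ENNReal.ofReal_sum_of_nonneg
      (fun s _ => div_nonneg (isingBoltzmann_pos J s).le (isingPairPartition_pos J).le),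
      ← Finset.sum_div]
    change ENNReal.ofReal (isingPairPartition J / isingPairPartition J) = 1
    rw [div_self (isingPairPartition_pos J).ne', ENNReal.ofReal_one])

/-- **The Ising magnetization law**: the law on `ℝ` of `Σᵢ wᵢ sᵢ` under the finite Ising Gibbs
probability with pair couplings `J` — a finite mixture of Dirac masses, as an honest
`ProbabilityMeasure ℝ`. [Newman 1974, §1; Lee–Yang 1952, §II] [cite: Newman1974, §1] -/
def isingMagnetizationLaw (n : ℕ) (J : Fin n → Fin n → ℝ) (w : Fin n → ℝ) :
    ProbabilityMeasure ℝ :=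
  ⟨((isingPairPMF J).map (weightedMagnetization w)).toMeasure, inferInstance⟩

/-- The complex partition function in an external field `z` coupled through the weights `w`:
`Z(z) = Σ_s exp(Σ Jᵢⱼ sᵢ sⱼ + z Σ wᵢ sᵢ)`. [Lee–Yang 1952, eq. (2) and Appendix II; Newman 1974, eq. (1.1)] [cite: LeeYang1952, Appendix II] -/
def isingFieldPartition (J : Fin n → Fin n → ℝ) (w : Fin n → ℝ) (z : ℂ) : ℂ :=
  ∑ s : Fin n → Bool, (isingBoltzmann J s : ℂ) * Complex.exp (z * weightedMagnetization w s)

end Finite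

/-! ### Ising limit laws -/

/-- **Ising limit laws**: `ν` is a weak limit (in `ProbabilityMeasure ℝ`) of magnetization laws
of finite FERROMAGNETIC Ising systems (`J ≥ 0` entrywise) with non-negative weights, along which
the Gaussian-exponential moments `∫ e^{b u²}` stay bounded for every `b ∈ ℝ` (so that Laplace
transforms converge locally uniformly and Hurwitz's theorem applies). [Newman 1974, Thm. 3
(limits of Lee–Yang measures); Simon–Griffiths 1973, §II] [cite: Newman1974, Thm. 3] -/
def IsIsingLimitLaw (ν : ProbabilityMeasure ℝ) : Prop :=
  ∃ (n : ℕ → ℕ) (J : ∀ k, Fin (n k) → Fin (n k) → ℝ) (w : ∀ k, Fin (n k) → ℝ),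
    (∀ k i j, 0 ≤ J k i j) ∧ (∀ k i, 0 ≤ w k i) ∧
      Tendsto (fun k => isingMagnetizationLaw (n k) (J k) (w k)) atTop (𝓝 ν) ∧
        ∀ b : ℝ, ∃ C : ℝ, ∀ k,
          ∫ u, Real.exp (b * u ^ 2) ∂(isingMagnetizationLaw (n k) (J k) (w k) : Measure ℝ) ≤ C

/-! ### The circle theorem: from `lee_yang_circle_theorem_finite` -/

section Flip

variable {n : ℕ}

/-- The global spin flip negates each spin. [Lee–Yang 1952, §II] [folklore] -/
theorem spinVal_flip (s : Fin n → Bool) (i : Fin n) :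
    spinVal (fun j => !s j) i = -spinVal s i := by
  unfold spinVal; cases h : s i <;> simp [h]

/-- The pair energy is invariant under the global spin flip. [Lee–Yang 1952, §II] [folklore] -/
theorem isingPairEnergy_flip (J : Fin n → Fin n → ℝ) (s : Fin n → Bool) :
    isingPairEnergy J (fun j => !s j) = isingPairEnergy J s := by
  simp only [isingPairEnergy, spinVal_flip, mul_neg, neg_mul, neg_neg]

/-- The magnetization is odd under the global spin flip. [Lee–Yang 1952, §II] [folklore] -/
theorem weightedMagnetization_flip (w : Fin n → ℝ) (s : Fin n → Bool) :
    weightedMagnetization w (fun j => !s j) = -weightedMagnetization w s := by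
  simp only [weightedMagnetization, spinVal_flip, mul_neg, Finset.sum_neg_distrib]

/-- `Z(-z) = Z(z)` (spin-flip symmetry in zero field). [Lee–Yang 1952, §II] [folklore] -/
theorem isingFieldPartition_neg (J : Fin n → Fin n → ℝ) (w : Fin n → ℝ) (z : ℂ) :
    isingFieldPartition J w (-z) = isingFieldPartition J w z := by
  unfold isingFieldPartition
  refine Fintype.sum_equiv (Function.Involutive.toPerm (fun s : Fin n → Bool => fun j => !s j)
    (fun s => by funext j; simp)) _ _ fun s => ?_
  simp only [Function.Involutive.coe_toPerm, isingBoltzmann, isingPairEnergy_flip,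
    weightedMagnetization_flip, Complex.ofReal_neg, mul_neg, neg_mul]

/-- The product of two spins is `+1` if they agree and `-1` otherwise (the tree fact's encoding).
[folklore] -/
theorem spinVal_mul_spinVal (s : Fin n → Bool) (i j : Fin n) :
    (spinVal s i : ℂ) * spinVal s j = if s i = s j then 1 else -1 := by
  unfold spinVal; cases s i <;> cases s j <;> simp

/-- `isingFieldPartition J w z` is the partition function of `lee_yang_circle_theorem_finite` with
fields `hᵢ = z wᵢ`. [Lee–Yang 1952, Appendix II] [folklore] -/
theorem isingFieldPartition_eq_sum_exp (J : Fin n → Fin n → ℝ) (w : Fin n → ℝ) (z : ℂ) :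
    isingFieldPartition J w z =
      ∑ σ : Fin n → Bool, Complex.exp ((∑ i, ∑ j, ((J i j : ℂ) * (if σ i = σ j then 1 else -1))) +
        ∑ i, (z * w i) * (if σ i then 1 else -1)) := by
  unfold isingFieldPartition isingBoltzmann isingPairEnergy weightedMagnetization
  refine Finset.sum_congr rfl fun s _ => ?_
  rw [Complex.ofReal_exp, ← Complex.exp_add]
  congr 1
  push_cast
  congr 1
  · refine Finset.sum_congr rfl fun i _ => Finset.sum_congr rfl fun j _ => ?_
    rw [mul_assoc, spinVal_mul_spinVal]
  · rw [Finset.mul_sum]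
    refine Finset.sum_congr rfl fun i _ => ?_
    unfold spinVal; cases s i <;> simp

end Flip

/-- **Lee–Yang circle theorem for `Z(z)`, strictly positive weights** — a THEOREM from the tree's
named fact `lee_yang_circle_theorem_finite` (fields `hᵢ = z wᵢ` have `Re hᵢ = wᵢ Re z > 0` for
`Re z > 0`; the half plane `Re z < 0` by the spin flip `Z(-z) = Z(z)`).
[Lee–Yang 1952, Appendix II] [folklore] -/
theorem lee_yang_ising_of_pos (h : lee_yang_circle_theorem_finite) {n : ℕ}
    {J : Fin n → Fin n → ℝ} {w : Fin n → ℝ} (hJ : ∀ i j, 0 ≤ J i j) (hw : ∀ i, 0 < w i)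
    {z : ℂ} (hz : z.re ≠ 0) : isingFieldPartition J w z ≠ 0 := by
  -- reduce to `Re z > 0` by the spin flip
  wlog hpos : 0 < z.re generalizing z
  · have hneg : 0 < (-z).re := by
      rw [Complex.neg_re]; rcases lt_or_gt_of_ne hz with hlt | hgt
      · linarith
      · exact absurd hgt (by simpa using hpos)
    rw [← isingFieldPartition_neg]
    exact this (by rw [Complex.neg_re]; exact neg_ne_zero.2 hz) hneg
  rw [isingFieldPartition_eq_sum_exp]
  exact h n J (fun i => z * w i) hJ fun i => by
    rw [Complex.re_mul_ofReal]; exact mul_pos hpos (hw i)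

/-! ### Named facts -/

/-- **Lee–Yang circle theorem, non-negative weights** (partition-function form): for entrywise
non-negative pair couplings `J` and weights `wᵢ ≥ 0` — zero weights ALLOWED — the partition
function `Z(z) = Σ_s exp(Σ Jᵢⱼ sᵢ sⱼ + z Σ wᵢ sᵢ)` does not vanish off the imaginary axis. This is
the `wᵢ = 0` extension of the tree fact `lee_yang_circle_theorem_finite` (which needs `Re hᵢ > 0`
for EVERY spin; the strictly positive case is the theorem `lee_yang_ising_of_pos` above), obtained
by letting the fields on the weight-zero spins tend to `0` and applying Hurwitz's theorem in `z`
(the limit is not identically zero: `Z(x) > 0` for real `x`), or directly from Lieb–Sokal's general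
theorem. Kept as a fact because `IsIsingLimitLaw` admits `w ≥ 0`. [Lieb–Sokal 1981, §3
(Cor. 3.3, fields in the closed half plane); Lee–Yang 1952, Appendix II] [cite: LiebSokal1981, §3] -/
def lee_yang_ising : Prop :=
  ∀ (n : ℕ) (J : Fin n → Fin n → ℝ) (w : Fin n → ℝ), (∀ i j, 0 ≤ J i j) → (∀ i, 0 ≤ w i) →
    ∀ z : ℂ, z.re ≠ 0 → isingFieldPartition J w z ≠ 0

/-- **Lee–Yang is closed under Ising limits**: an Ising limit law has the Lee–Yang property
(locally uniform convergence of the entire Laplace transforms from the uniform `e^{bu²}` bounds,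
then Hurwitz). [Newman 1974, Thm. 3; Lieb–Sokal 1981, §2 (closure properties)] [cite: Newman1974, Thm. 3] -/
def hasLeeYangProperty_of_isIsingLimitLaw : Prop :=
  ∀ ν : ProbabilityMeasure ℝ, IsIsingLimitLaw ν → HasLeeYangProperty (ν : Measure ℝ)

/-- **GHS inequality** for finite ferromagnetic Ising systems with non-negative fields: the
magnetization `h ↦ d/dh log ∫ e^{hu} d(law)(u)` is concave on `[0, ∞)`
(equivalently `∂³_h log Z(h) ≤ 0` for `h ≥ 0`). [Griffiths–Hurst–Sherman 1970, Thm.;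
Ellis–Monroe–Newman 1976, §1] [cite: GriffithsHurstSherman1970, Thm. 1] -/
def ghs_isingMagnetizationLaw : Prop :=
  ∀ (n : ℕ) (J : Fin n → Fin n → ℝ) (w : Fin n → ℝ), (∀ i j, 0 ≤ J i j) → (∀ i, 0 ≤ w i) →
    ConcaveOn ℝ (Set.Ici 0) (deriv fun h : ℝ =>
      Real.log (∫ u, Real.exp (h * u) ∂(isingMagnetizationLaw n J w : Measure ℝ)))

/-- **Simon–Griffiths**: for `a > 0` and `b ∈ ℝ`, the probability law on `ℝ` with density
`∝ exp(-a u⁴ - b u²)` is an Ising limit law (approximation of the `φ⁴` single-site measure by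
scaled block spins of ferromagnetic Ising systems). [Simon–Griffiths 1973, Thm. 1 / §II] [cite: GriffithsSimon1973, Thm. 1] -/
def isIsingLimitLaw_phi4 : Prop :=
  ∀ (a b : ℝ), 0 < a → ∀ ν : ProbabilityMeasure ℝ,
    (ν : Measure ℝ) = (∫⁻ u, ENNReal.ofReal (Real.exp (-a * u ^ 4 - b * u ^ 2)))⁻¹ •
        volume.withDensity (fun u => ENNReal.ofReal (Real.exp (-a * u ^ 4 - b * u ^ 2))) →
      IsIsingLimitLaw ν

/-! ### API -/

/-- The Laplace transform at `0` of a probability measure is `1`, so `0` is never a Lee–Yang zero.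
[folklore] -/
theorem HasLeeYangProperty.of_forall {μ : Measure ℝ}
    (h : ∀ z : ℂ, z.re ≠ 0 → (∫ u, Complex.exp (z * u) ∂μ) ≠ 0) : HasLeeYangProperty μ :=
  fun z hz => by_contra fun hre => h z hre hz

/-- The partition-function form of Lee–Yang gives non-vanishing at real nonzero `z` in particular.
[Lee–Yang 1952, Appendix II] [folklore] -/
theorem isingFieldPartition_ne_zero_of_real (h : lee_yang_ising) {n : ℕ} {J : Fin n → Fin n → ℝ}
    {w : Fin n → ℝ} (hJ : ∀ i j, 0 ≤ J i j) (hw : ∀ i, 0 ≤ w i) {x : ℝ} (hx : x ≠ 0) :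
    isingFieldPartition J w x ≠ 0 :=
  h n J w hJ hw x (by simpa using hx)

/-- At `z = 0` the field partition function is the (positive, real) partition function.
[Lee–Yang 1952, eq. (2)] [folklore] -/
theorem isingFieldPartition_zero {n : ℕ} (J : Fin n → Fin n → ℝ) (w : Fin n → ℝ) :
    isingFieldPartition J w 0 = (isingPairPartition J : ℂ) := by
  simp [isingFieldPartition, isingPairPartition]

/-- The magnetization law charges exactly the attainable magnetizations: its `PMF` support.
[Newman 1974, §1] [folklore] -/
theorem support_isingPairPMF_map {n : ℕ} (J : Fin n → Fin n → ℝ) (w : Fin n → ℝ) :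
    ((isingPairPMF J).map (weightedMagnetization w)).support =
      Set.range (weightedMagnetization w) := by
  rw [PMF.support_map]
  have : (isingPairPMF J).support = Set.univ := by
    ext s
    simp only [isingPairPMF, PMF.support_ofFintype, Function.mem_support, ne_eq,
      ENNReal.ofReal_eq_zero, not_le, Set.mem_univ, iff_true]
    exact div_pos (isingBoltzmann_pos J s) (isingPairPartition_pos J)
  rw [this, Set.image_univ]

/-- Configurations form a measurable space in which every map out is measurable. [folklore] -/
theorem measurable_of_config {n : ℕ} (f : (Fin n → Bool) → ℝ) : Measurable f :=
  measurable_of_countable f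

/-- **Laplace transform of the magnetization law**: `∫ e^{zu} d(law)(u) = Z(z) / Z(0)` (a finite
sum). [Newman 1974, eq. (1.1)–(1.2)] [folklore] -/
theorem integral_exp_isingMagnetizationLaw {n : ℕ} (J : Fin n → Fin n → ℝ) (w : Fin n → ℝ)
    (z : ℂ) :
    ∫ u, Complex.exp (z * u) ∂(isingMagnetizationLaw n J w : Measure ℝ) =
      isingFieldPartition J w z / isingPairPartition J := by
  change ∫ u, Complex.exp (z * u) ∂((isingPairPMF J).map (weightedMagnetization w)).toMeasure = _
  rw [← PMF.toMeasure_map (weightedMagnetization w) (isingPairPMF J) (measurable_of_config _),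
    integral_map (measurable_of_config _).aemeasurable (by fun_prop), PMF.integral_eq_sum,
    isingFieldPartition, Finset.sum_div]
  refine Finset.sum_congr rfl fun s _ => ?_
  have hp : ((isingPairPMF J) s).toReal = isingBoltzmann J s / isingPairPartition J := by
    rw [isingPairPMF, PMF.ofFintype_apply, ENNReal.toReal_ofReal
      (div_nonneg (isingBoltzmann_pos J s).le (isingPairPartition_pos J).le)]
  rw [hp, Complex.real_smul]
  push_cast
  ring

/-- **Lee–Yang property of Ising magnetization laws** — a THEOREM from `lee_yang_ising` via
`∫ e^{zu} d(law) = Z(z)/Z(0)`. [Newman 1974, Thm. 1; Lee–Yang 1952, Appendix II] [folklore] -/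
theorem hasLeeYangProperty_isingMagnetizationLaw (h : lee_yang_ising) {n : ℕ}
    {J : Fin n → Fin n → ℝ} {w : Fin n → ℝ} (hJ : ∀ i j, 0 ≤ J i j) (hw : ∀ i, 0 ≤ w i) :
    HasLeeYangProperty (isingMagnetizationLaw n J w : Measure ℝ) := by
  refine HasLeeYangProperty.of_forall fun z hz => ?_
  rw [integral_exp_isingMagnetizationLaw]
  exact div_ne_zero (h n J w hJ hw z hz)
    (Complex.ofReal_ne_zero.2 (isingPairPartition_pos J).ne')

/-- The same for strictly positive weights, from the tree fact `lee_yang_circle_theorem_finite`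
alone. [Lee–Yang 1952, Appendix II; Newman 1974, Thm. 1] [folklore] -/
theorem hasLeeYangProperty_isingMagnetizationLaw_of_pos (h : lee_yang_circle_theorem_finite)
    {n : ℕ} {J : Fin n → Fin n → ℝ} {w : Fin n → ℝ} (hJ : ∀ i j, 0 ≤ J i j) (hw : ∀ i, 0 < w i) :
    HasLeeYangProperty (isingMagnetizationLaw n J w : Measure ℝ) := by
  refine HasLeeYangProperty.of_forall fun z hz => ?_
  rw [integral_exp_isingMagnetizationLaw]
  exact div_ne_zero (lee_yang_ising_of_pos h hJ hw hz)
    (Complex.ofReal_ne_zero.2 (isingPairPartition_pos J).ne')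

/-- Non-vacuity: every finite ferromagnetic magnetization law is itself an Ising limit law
(constant sequence). [Newman 1974, §1] [folklore] -/
theorem isIsingLimitLaw_isingMagnetizationLaw {n : ℕ} {J : Fin n → Fin n → ℝ} {w : Fin n → ℝ}
    (hJ : ∀ i j, 0 ≤ J i j) (hw : ∀ i, 0 ≤ w i) : IsIsingLimitLaw (isingMagnetizationLaw n J w) :=
  ⟨fun _ => n, fun _ => J, fun _ => w, fun _ => hJ, fun _ => hw, tendsto_const_nhds,
    fun _ => ⟨_, fun _ => le_rfl⟩⟩

end Literature.Probability.LatticeModels
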